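import Mathlib
import Literature.Combinatorics.AssociationSchemes.JohnsonHarmonics
import Literature.Algebra.Polynomial.IntegerValuedPolynomials
import HarnessLib

/-!
# Grigoriev's knapsack pseudo-moments and the non-negativity of their moment form (Grigoriev 2001, Lemma 1.4)

A NAMED FACT plus its elementary API — and (appended 2026-08-26, final section) its PROOF
`Grigoriev2001_knapsackFormNonneg_holds` — sibling of `Mod2SosDegree.lean` (Grigoriev's
parity bound).  Source: D. Grigoriev, *Complexity of Positivstellensatz proofs for the knapsack*, comput.
complexity 10 (2001) 139–154 [Grigoriev2001] (held: `paper:doi-10-1007-s00037-001-8192-0`; locators are PDF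
pages of that copy).  Requested by cell `pnp-psdrank` (planner memo `pnp-psdrank-p1/ROUND-1.md` §4.2/§5 F3(i):
the hypothesis `GrigorievKnapsackPositivity m d r` of its `MomentImmunity` statement is Lemma 1.4 below
verbatim, with `(n, l) := (m, d)`).

Printed statements (verbatim up to notation).
* The knapsack system (0.7) (PDF p. 5): `f = X_1 + ⋯ + X_n − r = 0`, `f_i = X_i² − X_i = 0` (`1 ≤ i ≤ n`),
  `r ∈ ℝ`.
* §1 (PDF p. 7): "we consider a factor-algebra `A = ℝ[X_1,…,X_n]/(X_1² − X_1, …, X_n² − X_n)` which has a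
  canonical basis of the multilinear monomials `{X_I}` where `I ⊂ {1,…,n}`" — so `X_I · X_J = X_{I ∪ J}` in `A`.
* §1 (PDF p. 8): "Define a linear mapping `B : A → ℝ` by letting
  `B(X_I) = B_k = r(r−1)⋯(r−k+1) / (n(n−1)⋯(n−k+1))` for the basis elements `X_I` of `A` corresponding
  to any set `I` with `|I| = k` and extending linearly … Observe that the mapping `B` is symmetric and that
  `B(1) = B_0 = 1`."  — `knapsackMoment n r k` below.
* **Lemma 1.3** (PDF p. 8): "For a polynomial `g′` with `deg(g′) < n` we have `B(f g′) = 0`."  Its proof is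
  the identity "`B(f X_I) = (n−k) B_{k+1} + (k−r) B_k`" (`|I| = k < n`), which vanishes —
  `knapsackMoment_recurrence` below (PROVED).
* "We introduce a quadratic form `Q` in the space `⊕_{0 ≤ k ≤ ⌊n/2⌋} P_k` with the entry in the place
  `(X_I, X_J)` being equal to `B(X_I X_J)`. By `Q_l`, `l ≤ ⌊n/2⌋` we denote the restriction of `Q` onto the
  subspace `⊕_{0 ≤ k ≤ l} P_k`" (`P_k` = span of the degree-`k` multilinear monomials) — `knapsackForm`
  below is `h ↦ Q(h, h) = Σ_{I,J} h_I h_J B_{|I ∪ J|}` on coefficient vectors `h`.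
* **Lemma 1.4** (PDF p. 8, L34): "The quadratic form `Q_l` is non-negative when `l − 1 < r < n − l + 1`."
  — the named fact `Grigoriev2001_knapsackFormNonneg` (for `l ≤ ⌊n/2⌋`, the range in which `Q_l` is
  defined).  Its printed proof is §2 of the paper (PDF pp. 8–16: the kernel and eigenspaces of `Q_l`,
  positivity of the nonzero eigenvalues); the final section of this file PROVES it
  (`Grigoriev2001_knapsackFormNonneg_holds`) by the shorter route of Lee–Prakash–de Wolf–Yuen, App. C
  [LeePrakashDewolfYuen2016] (Blekherman's decomposition), over the Johnson-scheme ladder calculus of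
  `Literature.Combinatorics.AssociationSchemes.JohnsonHarmonics`.
* **Theorem (i)** (PDF p. 6): "Let `k` be a non-negative integer and suppose that `k < r < n − k`. (i) When
  `0 ≤ k ≤ (n−3)/2` the Positivstellensatz refutation degree of (0.7) is greater or equal to `2k + 4`" —
  deduced from Lemmas 1.3–1.4 on PDF pp. 8–9 (apply `B` to a refutation `1 + Σ h_j² = Σ f_i g_i + f g`:
  the right side vanishes by Lemma 1.3, each `B(h_j²) = h_j Q_{⌊d/2⌋} h_jᵀ ≥ 0` by Lemma 1.4 with
  `⌊d/2⌋ ≤ k + 1`, contradiction with `B(1) = 1`).  Restated as Thm 4.2 and shown TIGHT (refutations of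
  degree `2k+4` exist, Thm 4.3) in T. Lee, A. Prakash, R. de Wolf, H. Yuen, *On the sum-of-squares degree
  of symmetric quadratic functions*, CCC 2016 (arXiv:1601.02311, p. 14) [LeePrakashDewolfYuen2016].  The
  refutation-degree theorem is not restated here (the tree's static refutations `HasSOSRefutation` live in
  `SumOfSquaresRefutation.lean`; a user wanting Theorem (i) in that currency combines Lemma 1.3
  (`knapsackMoment_recurrence`) with the fact below exactly as on PDF p. 9).

Degree convention (the point the requesting memo asks to fix): Lemma 1.4 is about SQUARES `h²` with
`deg h ≤ l` — a moment matrix of order `l`, "SOS degree `2l`"; Theorem (i)'s `2k + 4` is the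
Positivstellensatz degree `max{deg h_j², deg(f_i g_i), deg(f g)}` (Def. 0.5), and the proof uses
`l = ⌊d/2⌋ ≤ k + 1`, i.e. squares of degree `≤ k + 1` are all that a refutation of degree `≤ 2k + 3` contains.
-/

noncomputable section

open Finset
open scoped BigOperators

namespace Literature.Computability.Complexity

/-- **Grigoriev's knapsack pseudo-moments** `B_k = r(r−1)⋯(r−k+1) / (n(n−1)⋯(n−k+1)) = ∏_{j<k} (r−j)/(n−j)`,
the value of the symmetric functional `B` on every multilinear monomial `X_I` with `|I| = k` (the
"uniform `r`-subset of `n` items" moments continued to real `r`). [cite: Grigoriev2001, §1 (definition of B, PDF p. 8)] -/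
def knapsackMoment (n : ℕ) (r : ℝ) (k : ℕ) : ℝ :=
  ∏ j ∈ Finset.range k, (r - j) / ((n : ℝ) - j)

/-- **The moment form** `Q(h, h) = B(h̄²) = Σ_{I,J} h_I h_J B_{|I ∪ J|}` of a multilinear polynomial
`h = Σ_I h_I X_I ∈ A = ℝ[X]/(X_i² − X_i)` (so `X_I X_J = X_{I∪J}`), given by its coefficient vector
`h : Finset (Fin n) → ℝ`; Grigoriev's `Q_l` is this form restricted to `h` supported on `|I| ≤ l`.
[cite: Grigoriev2001, §1 (quadratic form Q, Q_l; PDF p. 8)] -/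
def knapsackForm (n : ℕ) (r : ℝ) (h : Finset (Fin n) → ℝ) : ℝ :=
  ∑ I, ∑ J, h I * h J * knapsackMoment n r (I ∪ J).card

/-- **Grigoriev 2001, Lemma 1.4** (named fact, not proved here): "The quadratic form `Q_l` is
non-negative when `l − 1 < r < n − l + 1`" (`l ≤ ⌊n/2⌋`).  Unfolded: for all `n, l` with `2l ≤ n` and
real `r` with `l − 1 < r < n − l + 1`, every multilinear `h` of degree `≤ l` (coefficients vanishing on
`|I| > l`) has `B(h̄²) = Σ_{I,J} h_I h_J B_{|I∪J|} ≥ 0`, i.e. Grigoriev's symmetric knapsack functional is a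
degree-`2l` pseudo-expectation for `Σ X_i = r` whenever `r` is farther than `l − 1` from both `0` and `n`.
This is the positivity input of the knapsack degree bound `≥ 2k+4` (Theorem (i), `k < r < n−k`; tight by
[LeePrakashDewolfYuen2016, Thm 4.3]) and of Lee–Raghavendra–Steurer's Thm 5.3.
[cite: Grigoriev2001, Lemma 1.4 (PDF p. 8)] -/
def Grigoriev2001_knapsackFormNonneg : Prop :=
  ∀ (n l : ℕ) (r : ℝ), 2 * l ≤ n → (l : ℝ) - 1 < r → r < (n : ℝ) - l + 1 →
    ∀ h : Finset (Fin n) → ℝ, (∀ I, l < I.card → h I = 0) → 0 ≤ knapsackForm n r h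

/-! ### Elementary API (proved) -/

/-- `B(1) = B_0 = 1`. [cite: Grigoriev2001, §1 (PDF p. 8: "B(1) = B_0 = 1")] -/
@[simp] theorem knapsackMoment_zero (n : ℕ) (r : ℝ) : knapsackMoment n r 0 = 1 := by
  simp [knapsackMoment]

/-- `B_{k+1} = B_k · (r − k)/(n − k)`. [cite: Grigoriev2001, §1 (definition of B, PDF p. 8)] -/
theorem knapsackMoment_succ (n : ℕ) (r : ℝ) (k : ℕ) :
    knapsackMoment n r (k + 1) = knapsackMoment n r k * ((r - k) / ((n : ℝ) - k)) := by
  rw [knapsackMoment, knapsackMoment, Finset.prod_range_succ]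

/-- `B_1 = r/n`: the functional gives each variable `X_i` the value `r/n`. [cite: Grigoriev2001, §1 (PDF p. 8)] -/
theorem knapsackMoment_one (n : ℕ) (r : ℝ) : knapsackMoment n r 1 = r / n := by
  simp [knapsackMoment]

/-- **Lemma 1.3 in moment form**: `B(f · X_I) = (n − k) B_{k+1} + (k − r) B_k = 0` for `|I| = k < n`
(expanding `(Σ_i X_i − r) X_I = Σ_{i ∉ I} X_{I ∪ {i}} + (k − r) X_I` in `A`), i.e. the functional `B`
annihilates the ideal of `f = Σ X_i − r` below degree `n`. [cite: Grigoriev2001, Lemma 1.3 (PDF p. 8)] -/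
theorem knapsackMoment_recurrence (n : ℕ) (r : ℝ) {k : ℕ} (hk : k < n) :
    ((n : ℝ) - k) * knapsackMoment n r (k + 1) + ((k : ℝ) - r) * knapsackMoment n r k = 0 := by
  have hnk : (n : ℝ) - k ≠ 0 := by
    have : (k : ℝ) < n := by exact_mod_cast hk
    linarith
  rw [knapsackMoment_succ, ← mul_assoc, mul_comm ((n : ℝ) - k), mul_assoc, mul_div_cancel₀ _ hnk]
  ring

/-- The form on a polynomial supported on the empty monomial only is `h_∅² · B_0 = h_∅² ≥ 0` — the case
`l = 0` of Lemma 1.4, checked directly (non-vacuity of the statement's shape). [cite: Grigoriev2001, Lemma 1.4 (PDF p. 8)] -/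
theorem knapsackForm_nonneg_of_degree_zero (n : ℕ) (r : ℝ) (h : Finset (Fin n) → ℝ)
    (hh : ∀ I, 0 < I.card → h I = 0) : 0 ≤ knapsackForm n r h := by
  classical
  have hI : ∀ I : Finset (Fin n), I ≠ ∅ → h I = 0 := fun I hI =>
    hh I (Finset.card_pos.mpr (Finset.nonempty_iff_ne_empty.mpr hI))
  unfold knapsackForm
  rw [Finset.sum_eq_single (∅ : Finset (Fin n)) (fun I _ hI0 => by simp [hI I hI0]) (by simp)]
  rw [Finset.sum_eq_single (∅ : Finset (Fin n)) (fun J _ hJ0 => by simp [hI J hJ0]) (by simp)]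
  simp only [Finset.empty_union, Finset.card_empty, knapsackMoment_zero, mul_one]
  exact mul_self_nonneg _

/-- The case `l = 0` of the named fact holds unconditionally (sanity check of the quantifier shape).
[cite: Grigoriev2001, Lemma 1.4 (PDF p. 8)] -/
theorem Grigoriev2001_knapsackFormNonneg_zero (n : ℕ) (r : ℝ) (h : Finset (Fin n) → ℝ)
    (hh : ∀ I, 0 < I.card → h I = 0) : 0 ≤ knapsackForm n r h :=
  knapsackForm_nonneg_of_degree_zero n r h hh

/-- **Reading for the requesting route** (`pnp-psdrank-p1`, `GrigorievKnapsackPositivity m d r`):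
assuming the fact, for `2d ≤ m` and `d − 1 < r < m − d + 1` the knapsack functional with parameters
`(m, r)` is non-negative on squares of multilinear polynomials of degree `≤ d`:
`0 ≤ Σ_{A,B} a_A a_B B_{|A∪B|}`. [cite: Grigoriev2001, Lemma 1.4 (PDF p. 8)] -/
theorem Grigoriev2001_knapsackFormNonneg.apply (hG : Grigoriev2001_knapsackFormNonneg) {m d : ℕ}
    {r : ℝ} (hd : 2 * d ≤ m) (hr₁ : (d : ℝ) - 1 < r) (hr₂ : r < (m : ℝ) - d + 1)
    (a : Finset (Fin m) → ℝ) (ha : ∀ A, d < A.card → a A = 0) :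
    0 ≤ ∑ A, ∑ B, a A * a B * knapsackMoment m r (A ∪ B).card :=
  hG m d r hd hr₁ hr₂ a ha


/-! ## Proof of Lemma 1.4 (discharge of `Grigoriev2001_knapsackFormNonneg`)

Route: Lee–Prakash–de Wolf–Yuen [LeePrakashDewolfYuen2016, App. C] observe that Grigoriev's functional is
`G_r(p) = Sym^{uni}(p)(r)` (`Sym(x_S) = B_{|S|}(|x|)`, their Lemma B.7) and that Blekherman's
decomposition (their Thm. B.11) `Sym^{uni}(p²)(x) = Σ_j q_j(x) Π_{i<j} (x−i)(n−x−i)` with univariate sums of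
squares `q_j` makes `G_r(p²) ≥ 0` evident for `deg p − 1 ≤ r ≤ n − deg p + 1`. We formalise exactly this,
slice by slice, with the ladder calculus of
`Literature.Combinatorics.AssociationSchemes.JohnsonHarmonics` (harmonic decomposition
`h = Σ_{t,d} (Wᵀ)^d p_{t,d}`, Parseval on slices) in place of the tableau basis:
(§A) at INTEGER points `0 ≤ s ≤ n` the form is a slice average of a square,
`knapsackForm n s h · C(n,s) = Σ_{|S|=s} ĥ(S)²` (`B_{|K|}(s) C(n,s) = #{S ⊇ K : |S| = s}`);
(§B) both `r ↦ knapsackForm n r h` (`formPoly`) and the manifestly structured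
`R(r) = Σ_t c_t(r) Σ_{d,d'} ⟪p_{t,d}, p_{t,d'}⟫ g_{t,d}(r) g_{t,d'}(r)` (`sosPoly`,
`c_t = ((n−2t)!/n!) Π_{i<t}(X−i)(n−i−X)`, `g_{t,d} = Π_{j<d}(X−t−j)`) are polynomials of degree `≤ 2l ≤ n`
agreeing at the `n + 1` points `0, …, n` (`eval_slicePoly_natCast_mul_choose` is the factorial identity
`c_t(s) C(n,s) = C(n−2t, s−t)`), hence equal (`Literature.Algebra.Polynomial.IntegerValuedPolynomials.
eq_of_natDegree_le_of_eval_eq`); (§C) at real `r ∈ (l−1, n−l+1)` every `c_t(r) ≥ 0` (`t ≤ l`) and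
`Σ_{d,d'} ⟪p_d,p_{d'}⟫ g_d g_{d'} = ⟪Σ_d g_d p_d, Σ_d g_d p_d⟫ ≥ 0`. The intermediate polynomials live in
the sub-namespace `KnapsackFormNonnegProof`. -/

open Polynomial
open Literature.Combinatorics.AssociationSchemes.JohnsonHarmonics

namespace KnapsackFormNonnegProof

variable {n : ℕ}

/-! ### §A. The knapsack moments at integer points are slice averages -/

/-- `B_k(s) = ff s k / ff n k` at every real `s`.
[cite: Grigoriev2001, §1 (definition of B, PDF p. 8)] -/
theorem knapsackMoment_eq_ff_div (n : ℕ) (r : ℝ) (k : ℕ) :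
    knapsackMoment n r k = ff r k / ff (n : ℝ) k := by
  rw [knapsackMoment, ff, ff, prod_div_distrib]

/-- The number of `s`-subsets of `Fin n` containing a fixed `k`-set `K` is `C(n − k, s − k)` (`k ≤ s`).
[cite: LeePrakashDewolfYuen2016, App. B Lemma B.7 (Sym(m_k)(x) = |x|(|x|−1)⋯(|x|−k+1)/(n(n−1)⋯(n−k+1)); arXiv text chunk 20)] -/
theorem card_filter_superset {s : ℕ} (K : Finset (Fin n)) (hks : K.card ≤ s) :
    ((powersetCard s (univ : Finset (Fin n))).filter (fun S => K ⊆ S)).card =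
      (n - K.card).choose (s - K.card) := by
  have hc : (powersetCard (s - K.card) Kᶜ).card = (n - K.card).choose (s - K.card) := by
    rw [card_powersetCard, card_compl, Fintype.card_fin]
  rw [← hc]
  refine card_nbij' (fun S => S \ K) (fun S' => S' ∪ K) ?_ ?_ ?_ ?_
  · intro S hS
    rw [mem_coe, mem_filter, mem_powersetCard] at hS
    rw [mem_coe, mem_powersetCard]
    refine ⟨fun x hx => mem_compl.2 (mem_sdiff.1 hx).2, ?_⟩
    rw [card_sdiff_of_subset hS.2, hS.1.2]
  · intro S' hS'
    rw [mem_coe, mem_powersetCard] at hS'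
    rw [mem_coe, mem_filter, mem_powersetCard]
    have hdisj : Disjoint S' K := by
      rw [Finset.disjoint_left]
      intro x hx hxK
      exact (mem_compl.1 (hS'.1 hx)) hxK
    refine ⟨⟨subset_univ _, ?_⟩, subset_union_right⟩
    rw [card_union_of_disjoint hdisj, hS'.2]
    omega
  · intro S hS
    rw [mem_coe, mem_filter] at hS
    exact sdiff_union_of_subset hS.2
  · intro S' hS'
    rw [mem_coe, mem_powersetCard] at hS'
    have hdisj : Disjoint S' K := by
      rw [Finset.disjoint_left]
      intro x hx hxK
      exact (mem_compl.1 (hS'.1 hx)) hxK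
    show (S' ∪ K) \ K = S'
    ext x
    simp only [mem_sdiff, mem_union]
    constructor
    · rintro ⟨hx | hx, hxK⟩
      · exact hx
      · exact absurd hx hxK
    · intro hx
      exact ⟨Or.inl hx, fun hxK => (Finset.disjoint_left.1 hdisj) hx hxK⟩

/-- `B_{|K|}(s) · C(n, s) = #{S : |S| = s, K ⊆ S}` at integers `0 ≤ s ≤ n`.
[cite: LeePrakashDewolfYuen2016, App. B Lemma B.7 (Sym(m_k)(x) = |x|(|x|−1)⋯(|x|−k+1)/(n(n−1)⋯(n−k+1)); arXiv text chunk 20)] -/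
theorem knapsackMoment_natCast_mul_choose {s : ℕ} (hs : s ≤ n) (K : Finset (Fin n)) :
    knapsackMoment n (s : ℝ) K.card * (n.choose s : ℝ) =
      (((powersetCard s (univ : Finset (Fin n))).filter (fun S => K ⊆ S)).card : ℝ) := by
  set k := K.card with hk
  by_cases hks : k ≤ s
  · rw [card_filter_superset K hks, ← hk, knapsackMoment_eq_ff_div]
    have hkn : k ≤ n := hks.trans hs
    have hffn : ff (n : ℝ) k ≠ 0 := (ff_pos (by
      have : (k : ℝ) ≤ n := by exact_mod_cast hkn
      linarith)).ne'
    rw [div_mul_eq_mul_div, div_eq_iff hffn]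
    -- clear denominators with the nonzero factor `(s-k)! (n-s)! (n-k)!`
    have hD : ((s - k).factorial : ℝ) * ((n - s).factorial : ℝ) * ((n - k).factorial : ℝ) ≠ 0 := by
      positivity
    refine mul_right_cancel₀ hD ?_
    have h1 : ff (s : ℝ) k * ((s - k).factorial : ℝ) = (s.factorial : ℝ) := ff_natCast_mul_factorial hks
    have h2 : ff (n : ℝ) k * ((n - k).factorial : ℝ) = (n.factorial : ℝ) := ff_natCast_mul_factorial hkn
    have h3 : ((n.choose s : ℕ) : ℝ) * (s.factorial : ℝ) * ((n - s).factorial : ℝ) = (n.factorial : ℝ) := by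
      exact_mod_cast Nat.choose_mul_factorial_mul_factorial hs
    have h4 : (((n - k).choose (s - k) : ℕ) : ℝ) * ((s - k).factorial : ℝ) * ((n - s).factorial : ℝ) =
        ((n - k).factorial : ℝ) := by
      have := Nat.choose_mul_factorial_mul_factorial (Nat.sub_le_sub_right hs k)
      rw [show n - k - (s - k) = n - s by omega] at this
      exact_mod_cast this
    calc ff (s : ℝ) k * (n.choose s : ℝ) *
          (((s - k).factorial : ℝ) * ((n - s).factorial : ℝ) * ((n - k).factorial : ℝ))
        = (ff (s : ℝ) k * ((s - k).factorial : ℝ)) *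
            (((n.choose s : ℕ) : ℝ)) * ((n - s).factorial : ℝ) * ((n - k).factorial : ℝ) := by ring
      _ = (n.factorial : ℝ) * ((n - k).factorial : ℝ) := by
          rw [h1]
          calc (s.factorial : ℝ) * (n.choose s : ℝ) * ((n - s).factorial : ℝ) * ((n - k).factorial : ℝ)
              = ((n.choose s : ℝ) * (s.factorial : ℝ) * ((n - s).factorial : ℝ)) *
                  ((n - k).factorial : ℝ) := by ring
            _ = (n.factorial : ℝ) * ((n - k).factorial : ℝ) := by rw [h3]
      _ = (((n - k).choose (s - k) : ℕ) : ℝ) * ff (n : ℝ) k *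
            (((s - k).factorial : ℝ) * ((n - s).factorial : ℝ) * ((n - k).factorial : ℝ)) := by
          calc (n.factorial : ℝ) * ((n - k).factorial : ℝ)
              = (ff (n : ℝ) k * ((n - k).factorial : ℝ)) * ((n - k).factorial : ℝ) := by rw [h2]
            _ = (ff (n : ℝ) k * ((n - k).factorial : ℝ)) *
                  ((((n - k).choose (s - k) : ℕ) : ℝ) * ((s - k).factorial : ℝ) *
                    ((n - s).factorial : ℝ)) := by rw [h4]
            _ = _ := by ring
  · -- `|K| > s`: both sides vanish
    push Not at hks
    rw [knapsackMoment_eq_ff_div, ff_natCast_of_lt hks, zero_div, zero_mul]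
    symm
    rw [Nat.cast_eq_zero, card_eq_zero, filter_eq_empty_iff]
    intro S hS hKS
    have := card_le_card hKS
    rw [(mem_powersetCard.1 hS).2] at this
    omega

/-- `Σ_{T ⊆ S} h T` as a sum over all `T` with an indicator.
[cite: LeePrakashDewolfYuen2016, App. B Lemma B.7 (Sym(m_k)(x) = |x|(|x|−1)⋯(|x|−k+1)/(n(n−1)⋯(n−k+1)); arXiv text chunk 20)] -/
theorem zeta_eq_sum_ite (h : Finset (Fin n) → ℝ) (S : Finset (Fin n)) :
    zeta h S = ∑ T, if T ⊆ S then h T else 0 := by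
  rw [zeta_apply, ← sum_filter]
  congr 1
  ext T
  simp

/-- **Integer points**: `knapsackForm n s h · C(n, s) = Σ_{|S| = s} ĥ(S)²`, where `ĥ = zeta h` is
the multilinear polynomial with coefficients `h` evaluated on the cube.
[cite: LeePrakashDewolfYuen2016, App. B Lemma B.7 (Sym(m_k)(x) = |x|(|x|−1)⋯(|x|−k+1)/(n(n−1)⋯(n−k+1)); arXiv text chunk 20)] -/
theorem knapsackForm_natCast_mul_choose {s : ℕ} (hs : s ≤ n) (h : Finset (Fin n) → ℝ) :
    knapsackForm n (s : ℝ) h * (n.choose s : ℝ) =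
      ∑ S ∈ powersetCard s (univ : Finset (Fin n)), (zeta h S) ^ 2 := by
  calc knapsackForm n (s : ℝ) h * (n.choose s : ℝ)
      = ∑ I, ∑ J, h I * h J * (knapsackMoment n (s : ℝ) (I ∪ J).card * (n.choose s : ℝ)) := by
        unfold knapsackForm
        rw [sum_mul]
        refine sum_congr rfl fun I _ => ?_
        rw [sum_mul]
        exact sum_congr rfl fun J _ => by ring
    _ = ∑ I, ∑ J, h I * h J *
          ∑ S ∈ powersetCard s (univ : Finset (Fin n)), (if I ∪ J ⊆ S then (1 : ℝ) else 0) := by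
        refine sum_congr rfl fun I _ => sum_congr rfl fun J _ => ?_
        rw [knapsackMoment_natCast_mul_choose hs, card_filter, Nat.cast_sum]
        congr 1
        refine sum_congr rfl fun S _ => ?_
        split_ifs <;> simp
    _ = ∑ S ∈ powersetCard s (univ : Finset (Fin n)), ∑ I, ∑ J,
          (if I ⊆ S then h I else 0) * (if J ⊆ S then h J else 0) := by
        simp_rw [mul_sum]
        rw [sum_comm]
        refine (sum_congr rfl fun I _ => sum_comm).trans ?_
        rw [sum_comm]
        refine sum_congr rfl fun S _ => sum_congr rfl fun I _ => sum_congr rfl fun J _ => ?_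
        by_cases hI : I ⊆ S <;> by_cases hJ : J ⊆ S <;> simp [hI, hJ, union_subset_iff, mul_comm]
    _ = ∑ S ∈ powersetCard s (univ : Finset (Fin n)), (zeta h S) ^ 2 := by
        refine sum_congr rfl fun S _ => ?_
        rw [sq, zeta_eq_sum_ite, sum_mul_sum]

/-! ### §B. The two polynomials in `r` -/

/-- `B_k` as a polynomial in `r`.
[cite: Grigoriev2001, §1 (definition of B, PDF p. 8)] -/
def bPoly (n k : ℕ) : ℝ[X] := ∏ j ∈ range k, C (((n : ℝ) - j)⁻¹) * (X - C (j : ℝ))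

/-- `bPoly` evaluates to the knapsack moment `B_k(r)`. [cite: Grigoriev2001, §1 (definition of B, PDF p. 8)] -/
theorem eval_bPoly (n k : ℕ) (r : ℝ) : (bPoly n k).eval r = knapsackMoment n r k := by
  rw [bPoly, eval_prod, knapsackMoment]
  refine prod_congr rfl fun j _ => ?_
  rw [eval_mul, eval_C, eval_sub, eval_X, eval_C, div_eq_inv_mul]

/-- `deg B_k ≤ k`. [cite: Grigoriev2001, §1 (definition of B, PDF p. 8)] -/
theorem natDegree_bPoly_le (n k : ℕ) : (bPoly n k).natDegree ≤ k := by
  unfold bPoly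
  refine (natDegree_prod_le _ _).trans ?_
  have hdeg : ∀ j ∈ range k, (C (((n : ℝ) - j)⁻¹) * (X - C (j : ℝ))).natDegree ≤ 1 :=
    fun j _ => (natDegree_C_mul_le _ _).trans (natDegree_X_sub_C_le _)
  refine (sum_le_sum hdeg).trans ?_
  simp

/-- The knapsack form as a polynomial in `r`: `P_h = Σ_{I,J} h_I h_J B_{|I ∪ J|}`.
[cite: Grigoriev2001, Lemma 1.4 (PDF p. 8)] -/
def formPoly (n : ℕ) (h : Finset (Fin n) → ℝ) : ℝ[X] :=
  ∑ I, ∑ J, C (h I * h J) * bPoly n (I ∪ J).card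

/-- `formPoly` evaluates to the knapsack form `Q(h,h)` at `r`. [cite: Grigoriev2001, Lemma 1.4 (PDF p. 8)] -/
theorem eval_formPoly (h : Finset (Fin n) → ℝ) (r : ℝ) :
    (formPoly n h).eval r = knapsackForm n r h := by
  rw [formPoly, knapsackForm, eval_finsetSum]
  refine sum_congr rfl fun I _ => ?_
  rw [eval_finsetSum]
  refine sum_congr rfl fun J _ => ?_
  rw [eval_mul, eval_C, eval_bPoly]

/-- `deg P_h ≤ 2l` for `h` of degree `≤ l`. [cite: Grigoriev2001, Lemma 1.4 (PDF p. 8)] -/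
theorem natDegree_formPoly_le {l : ℕ} (h : Finset (Fin n) → ℝ) (hh : ∀ I, l < I.card → h I = 0) :
    (formPoly n h).natDegree ≤ 2 * l := by
  unfold formPoly
  refine natDegree_sum_le_of_forall_le _ _ fun I _ => natDegree_sum_le_of_forall_le _ _ fun J _ => ?_
  by_cases hI : l < I.card
  · rw [hh I hI, zero_mul, map_zero, zero_mul, natDegree_zero]; exact Nat.zero_le _
  by_cases hJ : l < J.card
  · rw [hh J hJ, mul_zero, map_zero, zero_mul, natDegree_zero]; exact Nat.zero_le _
  refine (natDegree_C_mul_le _ _).trans ((natDegree_bPoly_le _ _).trans ?_)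
  refine (card_union_le I J).trans ?_
  omega

/-- The slice-weight polynomial `c_t = ((n−2t)!/n!) · Π_{i<t} (X − i)(n − i − X)`.
[cite: LeePrakashDewolfYuen2016, App. C (proof of Grigoriev's theorem via Thm. B.11; arXiv text chunk 23)] -/
def slicePoly (n t : ℕ) : ℝ[X] :=
  C (((n - 2 * t).factorial : ℝ) / n.factorial) * ∏ i ∈ range t, ((X - C (i : ℝ)) * (C ((n : ℝ) - i) - X))

/-- Evaluation of the slice-weight polynomial. [cite: LeePrakashDewolfYuen2016, App. C (proof of Grigoriev's theorem via Thm. B.11; arXiv text chunk 23)] -/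
theorem eval_slicePoly (n t : ℕ) (r : ℝ) :
    (slicePoly n t).eval r =
      ((n - 2 * t).factorial : ℝ) / n.factorial * (ff r t * ff ((n : ℝ) - r) t) := by
  rw [slicePoly, eval_mul, eval_C, eval_prod, ff, ff, ← prod_mul_distrib]
  congr 1
  refine prod_congr rfl fun i _ => ?_
  simp only [eval_mul, eval_sub, eval_X, eval_C]
  ring

/-- `deg c_t ≤ 2t`. [cite: LeePrakashDewolfYuen2016, App. C (proof of Grigoriev's theorem via Thm. B.11; arXiv text chunk 23)] -/
theorem natDegree_slicePoly_le (n t : ℕ) : (slicePoly n t).natDegree ≤ 2 * t := by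
  unfold slicePoly
  refine (natDegree_C_mul_le _ _).trans ((natDegree_prod_le _ _).trans ?_)
  have hdeg : ∀ i ∈ range t, ((X - C (i : ℝ)) * (C ((n : ℝ) - i) - X)).natDegree ≤ 2 := by
    intro i _
    have h1 : (X - C (i : ℝ)).natDegree ≤ 1 := natDegree_X_sub_C_le _
    have h2 : (C ((n : ℝ) - i) - X).natDegree ≤ 1 := by
      rw [show C ((n : ℝ) - i) - X = -(X - C ((n : ℝ) - i)) by ring, natDegree_neg]
      exact natDegree_X_sub_C_le _
    exact natDegree_mul_le.trans (by omega)
  refine (sum_le_sum hdeg).trans ?_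
  simp [mul_comm]

/-- The ladder polynomial `g_{t,d} = Π_{j<d} (X − t − j)`, with `g_{t,d}(x) = ff (x − t) d`.
[cite: LeePrakashDewolfYuen2016, App. C (proof of Grigoriev's theorem via Thm. B.11; arXiv text chunk 23)] -/
def ladderPoly (t d : ℕ) : ℝ[X] := ∏ j ∈ range d, (X - C ((t : ℝ) + j))

/-- `g_{t,d}(x) = ff (x − t) d`. [cite: LeePrakashDewolfYuen2016, App. C (proof of Grigoriev's theorem via Thm. B.11; arXiv text chunk 23)] -/
theorem eval_ladderPoly (t d : ℕ) (x : ℝ) : (ladderPoly t d).eval x = ff (x - t) d := by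
  rw [ladderPoly, eval_prod, ff]
  refine prod_congr rfl fun j _ => ?_
  simp only [eval_sub, eval_X, eval_C]
  ring

/-- `deg g_{t,d} ≤ d`. [cite: LeePrakashDewolfYuen2016, App. C (proof of Grigoriev's theorem via Thm. B.11; arXiv text chunk 23)] -/
theorem natDegree_ladderPoly_le (t d : ℕ) : (ladderPoly t d).natDegree ≤ d := by
  unfold ladderPoly
  refine (natDegree_prod_le _ _).trans ?_
  have hdeg : ∀ j ∈ range d, (X - C ((t : ℝ) + j)).natDegree ≤ 1 := fun j _ => natDegree_X_sub_C_le _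
  refine (sum_le_sum hdeg).trans ?_
  simp

/-- The **slice-weight identity at integer points**: for `0 ≤ s ≤ n` and `2t ≤ n`,
`c_t(s) · C(n, s) = σ_t(s)` (the slice factor of the Johnson decomposition).
[cite: LeePrakashDewolfYuen2016, App. C (proof of Grigoriev's theorem via Thm. B.11; arXiv text chunk 23)] -/
theorem eval_slicePoly_natCast_mul_choose {s t : ℕ} (hs : s ≤ n) (ht : 2 * t ≤ n) :
    (slicePoly n t).eval (s : ℝ) * (n.choose s : ℝ) = sliceFactor n t s := by
  rw [eval_slicePoly, sliceFactor]
  by_cases hts : t ≤ s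
  · rw [if_pos hts]
    obtain ⟨m, rfl⟩ := Nat.exists_eq_add_of_le hts
    rw [Nat.add_sub_cancel_left]
    have hcast : ((n : ℝ) - (t + m : ℕ)) = ((n - (t + m) : ℕ) : ℝ) := by rw [Nat.cast_sub hs]
    have hcast2 : ((n : ℝ) - 2 * t) = ((n - 2 * t : ℕ) : ℝ) := by
      rw [Nat.cast_sub ht]; push_cast; ring
    rw [hcast, hcast2]
    by_cases hm : t + m ≤ n - t
    · -- main case
      have h1 : ff ((t + m : ℕ) : ℝ) t * (m.factorial : ℝ) = ((t + m).factorial : ℝ) := by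
        have := ff_natCast_mul_factorial (Nat.le_add_right t m)
        rwa [Nat.add_sub_cancel_left] at this
      have h2 : ff ((n - (t + m) : ℕ) : ℝ) t * ((n - (t + m) - t).factorial : ℝ) =
          ((n - (t + m)).factorial : ℝ) := ff_natCast_mul_factorial (by omega)
      have h3 : ff ((n - 2 * t : ℕ) : ℝ) m * ((n - 2 * t - m).factorial : ℝ) =
          ((n - 2 * t).factorial : ℝ) := ff_natCast_mul_factorial (by omega)
      have h4 : ((n.choose (t + m) : ℕ) : ℝ) * ((t + m).factorial : ℝ) * ((n - (t + m)).factorial : ℝ) =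
          (n.factorial : ℝ) := by exact_mod_cast Nat.choose_mul_factorial_mul_factorial hs
      have hE : n - 2 * t - m = n - (t + m) - t := by omega
      rw [hE] at h3
      set D : ℝ := ((n - (t + m) - t).factorial : ℝ) with hD
      have hD0 : D ≠ 0 := by positivity
      have hn0 : (n.factorial : ℝ) ≠ 0 := by positivity
      have hm0 : (m.factorial : ℝ) ≠ 0 := by positivity
      rw [div_mul_eq_mul_div, eq_div_iff hm0, div_mul_eq_mul_div, div_mul_eq_mul_div, div_eq_iff hn0]
      refine mul_right_cancel₀ hD0 ?_
      calc ((n - 2 * t).factorial : ℝ) * (ff ((t + m : ℕ) : ℝ) t * ff ((n - (t + m) : ℕ) : ℝ) t) *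
            (n.choose (t + m) : ℝ) * (m.factorial : ℝ) * D
          = ((n - 2 * t).factorial : ℝ) * (ff ((t + m : ℕ) : ℝ) t * (m.factorial : ℝ)) *
              (ff ((n - (t + m) : ℕ) : ℝ) t * D) * (n.choose (t + m) : ℝ) := by ring
        _ = ((n - 2 * t).factorial : ℝ) * (n.factorial : ℝ) := by
            rw [h1, h2]
            calc ((n - 2 * t).factorial : ℝ) * ((t + m).factorial : ℝ) * ((n - (t + m)).factorial : ℝ) *
                  (n.choose (t + m) : ℝ)
                = ((n - 2 * t).factorial : ℝ) * (((n.choose (t + m) : ℕ) : ℝ) * ((t + m).factorial : ℝ) *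
                    ((n - (t + m)).factorial : ℝ)) := by ring
              _ = _ := by rw [h4]
        _ = ff ((n - 2 * t : ℕ) : ℝ) m * (n.factorial : ℝ) * D := by rw [← h3]; ring
    · -- `s > n − t`: both sides vanish
      push Not at hm
      have hz1 : ff ((n - (t + m) : ℕ) : ℝ) t = 0 := ff_natCast_of_lt (by omega)
      have hz2 : ff ((n - 2 * t : ℕ) : ℝ) m = 0 := ff_natCast_of_lt (by omega)
      rw [hz1, hz2]; simp
  · rw [if_neg hts]
    push Not at hts
    rw [ff_natCast_of_lt hts]; simp

/-- The sum-of-squares side as a polynomial in `r`: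
`R = Σ_t c_t · Σ_{d,d'} ⟪p_{t,d}, p_{t,d'}⟫ g_{t,d} g_{t,d'}`.
[cite: LeePrakashDewolfYuen2016, App. C (proof of Grigoriev's theorem via Thm. B.11; arXiv text chunk 23)] -/
def sosPoly (n l : ℕ) (p : ℕ → ℕ → (Finset (Fin n) → ℝ)) : ℝ[X] :=
  ∑ t ∈ range (l + 1), slicePoly n t *
    ∑ d ∈ range (l + 1), ∑ d' ∈ range (l + 1), C (ip (p t d) (p t d')) * (ladderPoly t d * ladderPoly t d')

/-- Evaluation of `sosPoly`. [cite: LeePrakashDewolfYuen2016, App. C (proof of Grigoriev's theorem via Thm. B.11; arXiv text chunk 23)] -/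
theorem eval_sosPoly (l : ℕ) (p : ℕ → ℕ → (Finset (Fin n) → ℝ)) (x : ℝ) :
    (sosPoly n l p).eval x = ∑ t ∈ range (l + 1), (slicePoly n t).eval x *
      ∑ d ∈ range (l + 1), ∑ d' ∈ range (l + 1),
        ff (x - t) d * ff (x - t) d' * ip (p t d) (p t d') := by
  rw [sosPoly, eval_finsetSum]
  refine sum_congr rfl fun t _ => ?_
  rw [eval_mul, eval_finsetSum]
  congr 1
  refine sum_congr rfl fun d _ => ?_
  rw [eval_finsetSum]
  refine sum_congr rfl fun d' _ => ?_
  rw [eval_mul, eval_C, eval_mul, eval_ladderPoly, eval_ladderPoly]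
  ring

/-- `deg R ≤ 2l` (components with `t + d > l` vanish). [cite: LeePrakashDewolfYuen2016, App. C (proof of Grigoriev's theorem via Thm. B.11; arXiv text chunk 23)] -/
theorem natDegree_sosPoly_le {l : ℕ} (p : ℕ → ℕ → (Finset (Fin n) → ℝ))
    (hp0 : ∀ t d, l < t + d → p t d = 0) : (sosPoly n l p).natDegree ≤ 2 * l := by
  unfold sosPoly
  refine natDegree_sum_le_of_forall_le _ _ fun t _ => ?_
  by_cases ht : t ≤ l
  · refine natDegree_mul_le.trans ?_
    have hinner : (∑ d ∈ range (l + 1), ∑ d' ∈ range (l + 1),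
        C (ip (p t d) (p t d')) * (ladderPoly t d * ladderPoly t d')).natDegree ≤ 2 * (l - t) := by
      refine natDegree_sum_le_of_forall_le _ _ fun d _ =>
        natDegree_sum_le_of_forall_le _ _ fun d' _ => ?_
      by_cases hd : l < t + d
      · rw [hp0 t d hd, ip_zero_left, map_zero, zero_mul, natDegree_zero]
        exact Nat.zero_le _
      by_cases hd' : l < t + d'
      · rw [hp0 t d' hd', ip_zero_right, map_zero, zero_mul, natDegree_zero]
        exact Nat.zero_le _
      refine (natDegree_C_mul_le _ _).trans (natDegree_mul_le.trans ?_)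
      have := natDegree_ladderPoly_le t d
      have := natDegree_ladderPoly_le t d'
      omega
    have := natDegree_slicePoly_le n t
    omega
  · -- `t > l`: every `p t d` vanishes, the inner sum is `0`
    have h0 : (∑ d ∈ range (l + 1), ∑ d' ∈ range (l + 1),
        C (ip (p t d) (p t d')) * (ladderPoly t d * ladderPoly t d')) = 0 := by
      refine sum_eq_zero fun d _ => sum_eq_zero fun d' _ => ?_
      rw [hp0 t d (by omega), ip_zero_left, map_zero, zero_mul]
    rw [h0, mul_zero, natDegree_zero]
    exact Nat.zero_le _

/-! ### §C. The discharge -/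

/-- **The two polynomials agree at the integers `0, …, n`.**
[cite: LeePrakashDewolfYuen2016, App. C (proof of Grigoriev's theorem via Thm. B.11; arXiv text chunk 23)] -/
theorem eval_formPoly_natCast {l s : ℕ} (hl : 2 * l ≤ n) (hs : s ≤ n) {h : Finset (Fin n) → ℝ}
    {p : ℕ → ℕ → (Finset (Fin n) → ℝ)} (hp : ∀ t d, IsHarmonic t (p t d))
    (hdec : h = ∑ t ∈ range (l + 1), ∑ d ∈ range (l + 1), up^[d] (p t d)) :
    (formPoly n h).eval (s : ℝ) = (sosPoly n l p).eval (s : ℝ) := by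
  have hC : (n.choose s : ℝ) ≠ 0 := by
    have := Nat.choose_pos hs
    positivity
  refine mul_right_cancel₀ hC ?_
  rw [eval_formPoly, knapsackForm_natCast_mul_choose hs, hdec, slice_sum_zeta_sq hp s, eval_sosPoly,
    sum_mul]
  refine sum_congr rfl fun t ht => ?_
  have ht' : 2 * t ≤ n := by have := mem_range.1 ht; omega
  rw [mul_right_comm, eval_slicePoly_natCast_mul_choose hs ht']

/-- **`P_h = R`** as polynomials (both have degree `≤ 2l ≤ n` and agree at `n + 1` points).
[cite: LeePrakashDewolfYuen2016, App. C (proof of Grigoriev's theorem via Thm. B.11; arXiv text chunk 23)] -/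
theorem formPoly_eq_sosPoly {l : ℕ} (hl : 2 * l ≤ n) {h : Finset (Fin n) → ℝ}
    (hh : ∀ I, l < I.card → h I = 0)
    {p : ℕ → ℕ → (Finset (Fin n) → ℝ)} (hp : ∀ t d, IsHarmonic t (p t d))
    (hp0 : ∀ t d, l < t + d → p t d = 0)
    (hdec : h = ∑ t ∈ range (l + 1), ∑ d ∈ range (l + 1), up^[d] (p t d)) :
    formPoly n h = sosPoly n l p :=
  Literature.Algebra.Polynomial.IntegerValuedPolynomials.eq_of_natDegree_le_of_eval_eq
    ((natDegree_formPoly_le h hh).trans hl) ((natDegree_sosPoly_le p hp0).trans hl)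
    fun _ hs => eval_formPoly_natCast hl hs hp hdec

/-- The slice-weight polynomial is nonnegative on `[t − 1, n − t + 1]`, in particular on
`(l − 1, n − l + 1)` for `t ≤ l`.
[cite: LeePrakashDewolfYuen2016, App. C (proof of Grigoriev's theorem via Thm. B.11; arXiv text chunk 23)] -/
theorem eval_slicePoly_nonneg {t : ℕ} {r : ℝ} (h1 : (t : ℝ) - 1 < r) (h2 : r < (n : ℝ) - t + 1) :
    0 ≤ (slicePoly n t).eval r := by
  rw [eval_slicePoly]
  refine mul_nonneg (by positivity) (mul_nonneg (ff_pos h1).le (ff_pos (by linarith)).le)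

/-- The Gram-type inner sum is a square: `Σ_{d,d'} ff ff' ⟪p_d, p_{d'}⟫ = ⟪Σ_d ff_d p_d, Σ_d ff_d p_d⟫ ≥ 0`.
[cite: LeePrakashDewolfYuen2016, App. C (proof of Grigoriev's theorem via Thm. B.11; arXiv text chunk 23)] -/
theorem sum_sum_ff_mul_ip_nonneg (l t : ℕ) (x : ℝ) (p : ℕ → ℕ → (Finset (Fin n) → ℝ)) :
    0 ≤ ∑ d ∈ range (l + 1), ∑ d' ∈ range (l + 1),
      ff (x - t) d * ff (x - t) d' * ip (p t d) (p t d') := by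
  have key : ip (∑ d ∈ range (l + 1), ff (x - t) d • p t d) (∑ d ∈ range (l + 1), ff (x - t) d • p t d) =
      ∑ d ∈ range (l + 1), ∑ d' ∈ range (l + 1), ff (x - t) d * ff (x - t) d' * ip (p t d) (p t d') := by
    rw [ip_sum_left]
    refine sum_congr rfl fun d _ => ?_
    rw [ip_sum_right]
    refine sum_congr rfl fun d' _ => ?_
    rw [ip_smul_left, ip_smul_right, mul_assoc]
  rw [← key]
  exact ip_self_nonneg _

end KnapsackFormNonnegProof

open KnapsackFormNonnegProof in
/-- **Grigoriev 2001, Lemma 1.4 — PROVED.** "The quadratic form `Q_l` is non-negative when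
`l − 1 < r < n − l + 1`." Discharge of the named fact `Grigoriev2001_knapsackFormNonneg`, by the
Blekherman–Lee–Prakash–de Wolf–Yuen route: harmonic (Johnson) decomposition of `h`, slice inner
products, and a polynomial identity in `r` of degree `≤ 2l ≤ n` through the `n + 1` integer points,
where the form is a genuine slice average of a square.
[cite: Grigoriev2001, Lemma 1.4 (PDF p. 8)] [cite: LeePrakashDewolfYuen2016, App. C (proof of Thm C.1 via Thm B.11)] -/
theorem Grigoriev2001_knapsackFormNonneg_holds : Grigoriev2001_knapsackFormNonneg := by
  intro n l r hl hr1 hr2 h hh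
  obtain ⟨p, hp, hp0, hdec⟩ := exists_harmonic_decomposition (by omega) hh
  rw [← eval_formPoly, formPoly_eq_sosPoly hl hh hp hp0 hdec, eval_sosPoly]
  refine sum_nonneg fun t ht => mul_nonneg ?_ (sum_sum_ff_mul_ip_nonneg l t r p)
  have htl : t ≤ l := Nat.lt_succ_iff.1 (mem_range.1 ht)
  have htl' : (t : ℝ) ≤ l := by exact_mod_cast htl
  exact eval_slicePoly_nonneg (by linarith) (by linarith)


end Literature.Computability.Complexity

end
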